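import Summits.ValiantsHypothesis.ValiantsHypothesis.Theorems.KPlusLogSqLawStaticPathLowTips

/-!
# Route «KPlusLogSqLaw» — parametric max-weight independent set on a path: THEOREM T′ mirrored — the λ-HIGH TIPS of a corridor (uniqueness)

HONEST FRAMING.  Helper toward the crux `WeakLifting` (item `stmt-ValiantsHypothesis-19561`, route `KPlusLogSqLaw`, cell `pub-symmetroid`,
seat val-sym-lift-p4 g21, 2026-08-29) on the line of its witness-plan stub `stub_tridiagonalSectorB` (tropical twin of the STATIC tridiagonal
sector = parametric maximum-weight independent set on a path).  Mirror image (`y ↦ -y`) of `…StaticPathLowTips` for the EVEN–EVEN hops of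
THEOREM T′ (THEOREM-T.md §4): the λ-HIGH TIP of a window is the pair of lines at whose vertex `y - λθ` is MAXIMISED over the closed corridor — two
CEILINGS whose slopes straddle `λ` (a top corner), or a ceiling–floor pair with the floor flatter and the ceiling of slope `< λ` (a left tip), or with
the ceiling flatter and of slope `> λ` (a right tip); the predicate is again a hypothesis `hS`.  (1) `phi_ge_of_straddleTop/leftTypeHigh/rightTypeHigh`,
`phi_ge_of_highType` — the functional at a λ-high-type vertex dominates its value at any point weakly on the correct side of the two lines, equality only
at the vertex; (2) **`highTip_unique`** — a window has at most one λ-high tip.  Sign algebra only.  Statements about a labelled line arrangement;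
nothing here asserts anything about `WeakLifting`, `TropicalB`, `KPlusLogSqLaw`, the stub in its window, `MatrixDescartes`
(stmt-ValiantsHypothesis-18050) or `VP ≠ VNP`.
-/

set_option linter.dupNamespace false
set_option autoImplicit false

namespace Summit.ValiantsHypothesis.ValiantsHypothesis.Theorems.KPlusLogSqLaw

open Finset Classical

namespace StaticPathFold

noncomputable section

variable (a b : ℕ → ℝ)

/-! ## 1. The functional `y - λ θ` is dominated from above at a λ-high-type vertex -/

/-- type I*: two ceilings whose slopes straddle `λ`: any point weakly below both has functional value at most that of their vertex, with equality
only at the vertex. [folklore] -/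
theorem phi_ge_of_straddleTop (lam : ℝ) {e₁ e₂ : ℕ} (h1 : a e₁ < lam) (h2 : lam < a e₂) {τ y θ' y' : ℝ}
    (hy1 : y = L a b e₁ τ) (hy2 : y = L a b e₂ τ) (hc1 : y' ≤ L a b e₁ θ') (hc2 : y' ≤ L a b e₂ θ') :
    y' - lam * θ' ≤ y - lam * τ ∧ (y - lam * τ ≤ y' - lam * θ' → θ' = τ ∧ y' = y) := by
  have e1 := L_eq_L_add_mul a b e₁ τ θ'
  have e2 := L_eq_L_add_mul a b e₂ τ θ'
  rcases lt_trichotomy θ' τ with hlt | heq | hgt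
  · have : 0 < (a e₂ - lam) * (τ - θ') := mul_pos (by linarith) (by linarith)
    constructor
    · nlinarith
    · intro h; nlinarith
  · subst heq
    constructor
    · linarith
    · intro h; exact ⟨rfl, by linarith⟩
  · have : 0 < (lam - a e₁) * (θ' - τ) := mul_pos (by linarith) (by linarith)
    constructor
    · nlinarith
    · intro h; nlinarith

/-- type II*: a ceiling `e` and a flatter floor `o`, ceiling slope `< λ` (a left tip): any point weakly between the two lines has functional value at
most that of their vertex, with equality only at the vertex. [folklore] -/
theorem phi_ge_of_leftTypeHigh (lam : ℝ) {e o : ℕ} (hs : a o < a e) (hl : a e < lam) {τ y θ' y' : ℝ}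
    (hτ : τ = (b o - b e) / (a e - a o)) (hy : y = L a b e τ) (hce : y' ≤ L a b e θ') (hco : L a b o θ' ≤ y') :
    y' - lam * θ' ≤ y - lam * τ ∧ (y - lam * τ ≤ y' - lam * θ' → θ' = τ ∧ y' = y) := by
  have hθ : τ ≤ θ' := by rw [hτ, ← crossAbs_symm a b o e]; exact (L_le_L_iff_crossAbs_le a b hs θ').mp (hco.trans hce)
  have e2 := L_eq_L_add_mul a b e τ θ'
  have h0 : 0 ≤ (lam - a e) * (θ' - τ) := mul_nonneg (by linarith) (by linarith)
  constructor
  · nlinarith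
  · intro h
    have h3 : (lam - a e) * (θ' - τ) = 0 := by nlinarith
    rcases mul_eq_zero.mp h3 with h4 | h4
    · exact absurd h4 (by linarith)
    · have : θ' = τ := by linarith
      subst this
      exact ⟨rfl, by nlinarith⟩

/-- type III*: a ceiling `e` flatter than the floor `o`, ceiling slope `> λ` (a right tip): any point weakly between the two lines has functional
value at most that of their vertex, with equality only at the vertex. [folklore] -/
theorem phi_ge_of_rightTypeHigh (lam : ℝ) {e o : ℕ} (hs : a e < a o) (hl : lam < a e) {τ y θ' y' : ℝ}
    (hτ : τ = (b o - b e) / (a e - a o)) (hy : y = L a b e τ) (hce : y' ≤ L a b e θ') (hco : L a b o θ' ≤ y') :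
    y' - lam * θ' ≤ y - lam * τ ∧ (y - lam * τ ≤ y' - lam * θ' → θ' = τ ∧ y' = y) := by
  have hθ : θ' ≤ τ := by rw [hτ]; exact (L_le_L_iff_le_crossAbs a b hs θ').mp (hco.trans hce)
  have e2 := L_eq_L_add_mul a b e τ θ'
  have h0 : 0 ≤ (a e - lam) * (τ - θ') := mul_nonneg (by linarith) (by linarith)
  constructor
  · nlinarith
  · intro h
    have h3 : (a e - lam) * (τ - θ') = 0 := by nlinarith
    rcases mul_eq_zero.mp h3 with h4 | h4
    · exact absurd h4 (by linarith)
    · have : θ' = τ := by linarith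
      subst this
      exact ⟨rfl, by nlinarith⟩

/-! ## 2. λ-high-type pairs: the dispatcher, and uniqueness of the λ-high tip of a window -/

section HighTips

variable (lam : ℝ) (S : ℕ → ℕ → Prop)

/-- **the functional is maximised at a λ-high-type vertex over the weak wedge of its two lines**. [folklore] -/
theorem phi_ge_of_highType
    (hS : ∀ p q, S p q ↔
      ((Even p ∧ Even q ∧ ((a p < lam ∧ lam < a q) ∨ (a q < lam ∧ lam < a p))) ∨
       (Odd (p + q) ∧ (if Even p then a q < a p else a p < a q) ∧ (if Even p then a p else a q) < lam) ∨
       (Odd (p + q) ∧ (if Even p then a p < a q else a q < a p) ∧ lam < (if Even p then a p else a q))))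
    {p q : ℕ} (hpq : S p q) {θ' y' : ℝ}
    (wp : (Even p → y' ≤ L a b p θ') ∧ (¬ Even p → L a b p θ' ≤ y'))
    (wq : (Even q → y' ≤ L a b q θ') ∧ (¬ Even q → L a b q θ' ≤ y')) :
    y' - lam * θ' ≤ L a b p ((b q - b p) / (a p - a q)) - lam * ((b q - b p) / (a p - a q)) ∧
      (L a b p ((b q - b p) / (a p - a q)) - lam * ((b q - b p) / (a p - a q)) ≤ y' - lam * θ' →
        θ' = (b q - b p) / (a p - a q) ∧ y' = L a b p ((b q - b p) / (a p - a q))) := by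
  set τ := (b q - b p) / (a p - a q) with hτ
  rcases (hS p q).mp hpq with ⟨hpe, hqe, hstr⟩ | ⟨hodd, hs, hl⟩ | ⟨hodd, hs, hl⟩
  · -- type I*
    rcases hstr with ⟨h1, h2⟩ | ⟨h1, h2⟩
    · have hA : a p ≠ a q := ne_of_lt (h1.trans h2)
      exact phi_ge_of_straddleTop a b lam h1 h2 rfl (L_eq_L_crossAbs a b hA).symm (wp.1 hpe) (wq.1 hqe)
    · have hA : a p ≠ a q := (ne_of_lt (h1.trans h2)).symm
      have h := phi_ge_of_straddleTop a b lam h1 h2 (y := L a b p τ) (τ := τ) (L_eq_L_crossAbs a b hA).symm rfl (wq.1 hqe) (wp.1 hpe)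
      exact h
  · -- type II*: left tips with the ceiling flatter than `λ`
    by_cases hpe : Even p
    · rw [if_pos hpe] at hs hl
      have hqo : ¬ Even q := fun h => by rw [Nat.odd_add'] at hodd; exact (Nat.not_even_iff_odd.mpr (hodd.mpr hpe)) h
      have h := phi_ge_of_leftTypeHigh a b lam hs hl (τ := τ) (y := L a b p τ) (by rw [hτ]) rfl (wp.1 hpe) (wq.2 hqo)
      exact h
    · rw [if_neg hpe] at hs hl
      have hqe : Even q := by rw [Nat.odd_add] at hodd; exact hodd.mp (Nat.not_even_iff_odd.mp hpe)
      have hA : a p ≠ a q := ne_of_lt hs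
      have h := phi_ge_of_leftTypeHigh a b lam hs hl (τ := τ) (y := L a b p τ) (by rw [hτ, crossAbs_symm])
        (L_eq_L_crossAbs a b hA).symm (wq.1 hqe) (wp.2 hpe)
      exact h
  · -- type III*: right tips with the ceiling steeper than `λ`
    by_cases hpe : Even p
    · rw [if_pos hpe] at hs hl
      have hqo : ¬ Even q := fun h => by rw [Nat.odd_add'] at hodd; exact (Nat.not_even_iff_odd.mpr (hodd.mpr hpe)) h
      have h := phi_ge_of_rightTypeHigh a b lam hs hl (τ := τ) (y := L a b p τ) (by rw [hτ]) rfl (wp.1 hpe) (wq.2 hqo)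
      exact h
    · rw [if_neg hpe] at hs hl
      have hqe : Even q := by rw [Nat.odd_add] at hodd; exact hodd.mp (Nat.not_even_iff_odd.mp hpe)
      have hA : a p ≠ a q := (ne_of_lt hs).symm
      have h := phi_ge_of_rightTypeHigh a b lam hs hl (τ := τ) (y := L a b p τ) (by rw [hτ, crossAbs_symm])
        (L_eq_L_crossAbs a b hA).symm (wq.1 hqe) (wp.2 hpe)
      exact h

/-- **A WINDOW HAS AT MOST ONE λ-HIGH TIP** (mirror of `lowTip_unique`; hypothesis (U) of the signed counting lemma). [folklore] -/
theorem highTip_unique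
    (hS : ∀ p q, S p q ↔
      ((Even p ∧ Even q ∧ ((a p < lam ∧ lam < a q) ∨ (a q < lam ∧ lam < a p))) ∨
       (Odd (p + q) ∧ (if Even p then a q < a p else a p < a q) ∧ (if Even p then a p else a q) < lam) ∨
       (Odd (p + q) ∧ (if Even p then a p < a q else a q < a p) ∧ lam < (if Even p then a p else a q))))
    (i j p q p' q' : ℕ)
    (hp : i ≤ p) (hpq : p < q) (hq : q ≤ j) (hSpq : S p q)
    (hG : ∀ t, i ≤ t → t ≤ j → t ≠ p → t ≠ q →
      0 < gap t (L a b p ((b q - b p) / (a p - a q))) (L a b t ((b q - b p) / (a p - a q))))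
    (hp' : i ≤ p') (hpq' : p' < q') (hq' : q' ≤ j) (hSpq' : S p' q')
    (hG' : ∀ t, i ≤ t → t ≤ j → t ≠ p' → t ≠ q' →
      0 < gap t (L a b p' ((b q' - b p') / (a p' - a q'))) (L a b t ((b q' - b p') / (a p' - a q')))) :
    p = p' ∧ q = q' := by
  set τ := (b q - b p) / (a p - a q) with hτ
  set τ' := (b q' - b p') / (a p' - a q') with hτ'
  set y := L a b p τ with hy
  set y' := L a b p' τ' with hy'
  have hA : ∀ u v, S u v → a u ≠ a v := by
    intro u v h
    rcases (hS u v).mp h with ⟨-, -, h⟩ | ⟨-, h, -⟩ | ⟨-, h, -⟩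
    · rcases h with ⟨h1, h2⟩ | ⟨h1, h2⟩
      · exact ne_of_lt (h1.trans h2)
      · exact (ne_of_lt (h1.trans h2)).symm
    · split_ifs at h
      · exact (ne_of_lt h).symm
      · exact ne_of_lt h
    · split_ifs at h
      · exact ne_of_lt h
      · exact (ne_of_lt h).symm
  have hyq : y = L a b q τ := by rw [hy, hτ]; exact (L_eq_L_crossAbs a b (hA p q hSpq)).symm
  have hyq' : y' = L a b q' τ' := by rw [hy', hτ']; exact (L_eq_L_crossAbs a b (hA p' q' hSpq')).symm
  have wk : ∀ t, i ≤ t → t ≤ j → (Even t → y' ≤ L a b t τ') ∧ (¬ Even t → L a b t τ' ≤ y') := by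
    intro t ht1 ht2
    by_cases htp : t = p'
    · subst htp; exact ⟨fun _ => le_of_eq hy', fun _ => le_of_eq hy'.symm⟩
    by_cases htq : t = q'
    · subst htq; exact ⟨fun _ => le_of_eq hyq', fun _ => le_of_eq hyq'.symm⟩
    exact weak_of_gap_pos (hG' t ht1 ht2 htp htq)
  have wk' : ∀ t, i ≤ t → t ≤ j → (Even t → y ≤ L a b t τ) ∧ (¬ Even t → L a b t τ ≤ y) := by
    intro t ht1 ht2
    by_cases htp : t = p
    · subst htp; exact ⟨fun _ => le_of_eq hy, fun _ => le_of_eq hy.symm⟩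
    by_cases htq : t = q
    · subst htq; exact ⟨fun _ => le_of_eq hyq, fun _ => le_of_eq hyq.symm⟩
    exact weak_of_gap_pos (hG t ht1 ht2 htp htq)
  have h1 := phi_ge_of_highType a b lam S hS hSpq (wk p hp (by omega)) (wk q (by omega) hq)
  have h2 := phi_ge_of_highType a b lam S hS hSpq' (wk' p' hp' (by omega)) (wk' q' (by omega) hq')
  obtain ⟨hθ, hyy⟩ := h1.2 h2.1
  have hmem : ∀ t, t = p ∨ t = q → t = p' ∨ t = q' := by
    intro t ht
    by_contra hne
    push Not at hne
    have hti : i ≤ t := by rcases ht with ht | ht <;> omega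
    have htj : t ≤ j := by rcases ht with ht | ht <;> omega
    have hg := hG' t hti htj hne.1 hne.2
    have hval : L a b t τ' = y' := by
      rcases ht with ht | ht
      · rw [ht, hyy, hθ]
      · rw [ht, hyy, hθ, ← hτ, ← hy]; exact hyq.symm
    rw [hval] at hg
    exact gap_self_not_pos t y' hg
  rcases hmem p (Or.inl rfl) with e1 | e1 <;> rcases hmem q (Or.inr rfl) with e2 | e2
  · omega
  · exact ⟨e1, e2⟩
  · omega
  · omega

end HighTips

end

end StaticPathFold

end Summit.ValiantsHypothesis.ValiantsHypothesis.Theorems.KPlusLogSqLaw
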